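import Literature.NumberTheory.Weil1964.ArchFollandKroneckerRows
import Literature.Analysis.SegalBargmann.FockRowDeterminantIsotypic
import HarnessLib

/-!
# The compact group of the place `ι₁`: `det`-isotypic Fock polynomials are `ℂ · det z` (junction D4 ↔ row determinant)

Topic `NumberTheory/Weil1964`; namespace `Literature.NumberTheory.Weil1964`.  Proved lemmas only: **no named facts, no
records, 0 proof holes**.  Setting of LEAF D4 (`ArchFollandKroneckerRows`): Folland variables `e : p × m ≃ ι`, product
scaling `D = D₀ ⊗ D₁`, sign vector constant along the `W`-columns (`ε (e (a, j)) = ε_V a · w₀`: `W` definite at the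
place), adapted `V`-scaling `mm D₀_a² = ε_V a t_a`; the compact group of the place = the form-preserving
(`A ∈ U(diag t)`) sign-block (`IsSignBlock ε_V A`) matrices acting through the Folland unitary of `A ⊗ 1`; two `V`-rows
`α 0, α 1` of sign `+1` and two columns `β : Fin 2 ≃ m` (the place `ι₁` of the pub-hodgecm cell: `V = U(2,1)`, `W`
definite of rank 2).
* §1 test elements: unit DIAGONAL matrices (`diagGL`; substitution = scaling of each variable,
  `linSubst_star_follandUnitary_kronecker_diagonal_X`) and the SCALED ROW SWAP `swapMat D₀ α = D₀⁻¹ P_{α0↔α1} D₀`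
  (`swapGL`: involutive, form-preserving, sign-block, `det` of its `α`-block `= −1`, substitution = `rename` by the row
  swap, `linSubst_star_follandUnitary_kronecker_swap_X`);
* §2 **`exists_eq_smul_det2_of_forall_form`**: if `G ∘ V_A⁻¹ = det(A|_α) • G` for every form-preserving sign-block `A`
  (the `det`-character of D4 §5), then `G = c • det2 ((a', j') ↦ e (α a', β j'))` — circle scalings give row weights
  `(1,1)` and `0` off the `α`-rows (`FockRowDeterminantIsotypic.isWeightedHomogeneous_indWt_of_linSubst`), the scaled
  swap gives antisymmetry, then `FockRowDeterminantIsotypic.eq_det2_mul_of_rowSwap`.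
The converse is D4's `linSubst_star_placeBlock_kronecker_det2`.  Use (pub-hodgecm rows A12/A34, junction J2 of the
census design): the `κ`-isotypic homogeneous Fock polynomials at `ι₁` are `ℂ · det z` (the statement PerL v5
Lemma 4.1(b) claims; kernel-proved here — PerL is a locator, not a source).
References: [Folland1989] G. B. Folland, *Harmonic Analysis in Phase Space* (1989), Prop. (4.39), Ch. 4 §5; [KashiwaraVergne1978]
M. Kashiwara, M. Vergne, Invent. Math. 44 (1978), Ch. III §5.  Provenance: LEAN-IN-TREE rule (2026-08-18), pub-hodgecm, binder-2; KERNEL.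
-/

set_option autoImplicit false

noncomputable section

open scoped Matrix Kronecker ComplexConjugate BigOperators
open Complex MvPolynomial
open Literature.Analysis.SegalBargmann Literature.NumberTheory.Automorphic Literature.NumberTheory.Automorphic.UnitaryGroup

namespace Literature.NumberTheory.Weil1964

variable {p m ι : Type*} [Fintype p] [DecidableEq p] [Fintype m] [DecidableEq m] [Fintype ι] [DecidableEq ι]

/-! ## §1 Test elements -/

section Diagonal

omit [Fintype m] in
/-- **Substitution of a DIAGONAL element**: each Folland variable is scaled,
`X (e (a, j)) ↦ signConj ε (e (a,j)) (conj (c a)) • X (e (a, j))`. [cite: Folland1989, Prop (4.39)] -/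
theorem linSubst_star_follandUnitary_kronecker_diagonal_X (e : p × m ≃ ι) (c : p → ℂ) {D ε : ι → ℝ} {D₀ : p → ℝ}
    {D₁ : m → ℝ} {εV : p → ℝ} {εW : m → ℝ} (hD : ∀ a j, D (e (a, j)) = D₀ a * D₁ j) (hD₁ : ∀ j, D₁ j ≠ 0)
    (hD₀ : ∀ a, D₀ a ≠ 0) (hε : ∀ a j, ε (e (a, j)) = εV a * εW j) (a : p) (j : m) :
    linSubst (star (follandUnitaryMatrix D ε (Matrix.reindex e e (Matrix.diagonal c ⊗ₖ (1 : Matrix m m ℂ)))))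
        (X (e (a, j))) = C (signConj ε (e (a, j)) (star (c a))) * X (e (a, j)) := by
  have hblock := isSignBlock_reindex_kronecker_one e (Matrix.diagonal c) (isSignBlock_diagonal εV c) hε
  rw [linSubst_star_follandUnitary_kronecker_X e _ hD hD₁ hblock a j, Finset.sum_eq_single a]
  · rw [Matrix.diagonal_apply_eq, div_self (hD₀ a), Complex.ofReal_one, one_mul]
  · intro b _ hb
    rw [Matrix.diagonal_apply_ne _ hb, star_zero, signConj_zero, mul_zero, C_0, zero_mul]
  · exact fun h => (h (Finset.mem_univ a)).elim

/-- A diagonal matrix with nonzero entries as an element of `GL`. [folklore] -/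
def diagGL (c : p → ℂ) (hc : ∀ a, c a ≠ 0) : GL p ℂ :=
  Matrix.GeneralLinearGroup.mkOfDetNeZero (Matrix.diagonal c)
    (by rw [Matrix.det_diagonal]; exact Finset.prod_ne_zero_iff.mpr fun a _ => hc a)

/-- Its matrix. [folklore] -/
@[simp] theorem coe_diagGL (c : p → ℂ) (hc : ∀ a, c a ≠ 0) :
    ((diagGL c hc : GL p ℂ) : Matrix p p ℂ) = Matrix.diagonal c :=
  Matrix.GeneralLinearGroup.val_mkOfDetNeZero _ _

/-- **A diagonal matrix with unit-modulus entries preserves every real diagonal form.** [folklore] -/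
theorem diagGL_mem_unitaryGroupOfForm (c : p → ℂ) (hc : ∀ a, star (c a) * c a = 1) (hc0 : ∀ a, c a ≠ 0)
    (t : p → ℝ) : diagGL c hc0 ∈ unitaryGroupOfForm (starRingEnd ℂ) ((Matrix.diagonal t).map Complex.ofRealHom) := by
  rw [mem_unitaryGroupOfForm_iff, coe_diagGL, Matrix.diagonal_map (map_zero _), Matrix.diagonal_transpose,
    Matrix.diagonal_map (map_zero _), Matrix.diagonal_mul_diagonal, Matrix.diagonal_mul_diagonal]
  congr 1
  funext a
  rw [mul_comm, ← mul_assoc, ← Complex.star_def, mul_comm (c a), hc, one_mul]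

end Diagonal

section Swap

variable (D₀ : p → ℝ) (α : Fin 2 → p)

/-- **The scaled row swap** `D₀⁻¹ P_{α 0 ↔ α 1} D₀`: entries `(D₀ a / D₀ b) · [b = σ a]`, `σ = swap (α 0) (α 1)` — real.
[folklore] -/
def swapMat : Matrix p p ℂ :=
  Matrix.of fun b a => (((D₀ a / D₀ b) * (if b = Equiv.swap (α 0) (α 1) a then 1 else 0) : ℝ) : ℂ)

omit [Fintype p] in
/-- Entries of `swapMat`. [folklore] -/
theorem swapMat_apply (b a : p) : swapMat D₀ α b a =
    (((D₀ a / D₀ b) * (if b = Equiv.swap (α 0) (α 1) a then 1 else 0) : ℝ) : ℂ) := rfl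

variable {D₀} (hD₀ : ∀ a, D₀ a ≠ 0)
include hD₀

omit hD₀ [Fintype p] in
/-- `swapMat` has real entries. [folklore] -/
theorem swapMat_map_conj : (swapMat D₀ α).map (starRingEnd ℂ) = swapMat D₀ α := by
  ext b a
  rw [Matrix.map_apply, swapMat_apply, Complex.conj_ofReal]

/-- `swapMat` is an involution. [folklore] -/
theorem swapMat_mul_self : swapMat D₀ α * swapMat D₀ α = 1 := by
  ext b c
  rw [Matrix.mul_apply, Finset.sum_eq_single (Equiv.swap (α 0) (α 1) b)]
  · rw [swapMat_apply, swapMat_apply, Equiv.swap_apply_self, if_pos rfl, mul_one, Matrix.one_apply]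
    by_cases hbc : b = c
    · subst hbc
      rw [if_pos rfl, mul_one, if_pos rfl, ← Complex.ofReal_mul, ← Complex.ofReal_one]
      congr 1
      have := hD₀ b; have := hD₀ (Equiv.swap (α 0) (α 1) b)
      field_simp
    · rw [if_neg (fun h => hbc ((Equiv.swap (α 0) (α 1)).injective h)), mul_zero, Complex.ofReal_zero, mul_zero,
        if_neg hbc]
  · intro a _ ha
    rw [swapMat_apply, if_neg (fun h => ha (by rw [h, Equiv.swap_apply_self])), mul_zero, Complex.ofReal_zero,
      zero_mul]
  · exact fun h => (h (Finset.mem_univ _)).elim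

/-- `swapMat` as an element of `GL`. [folklore] -/
def swapGL : GL p ℂ :=
  Matrix.GeneralLinearGroup.mkOfDetNeZero (swapMat D₀ α) (by
    intro h0
    have h1 := congrArg Matrix.det (swapMat_mul_self α hD₀)
    exact zero_ne_one (by rwa [Matrix.det_mul, h0, zero_mul, Matrix.det_one] at h1))

/-- Its matrix. [folklore] -/
@[simp] theorem coe_swapGL : ((swapGL α hD₀ : GL p ℂ) : Matrix p p ℂ) = swapMat D₀ α :=
  Matrix.GeneralLinearGroup.val_mkOfDetNeZero _ _

/-- **The scaled swap preserves `diag(t)`** when the scaling is adapted (`mm D₀² = ε_V t`) and the two swapped rows have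
the same sign. [folklore] -/
theorem swapGL_mem_unitaryGroupOfForm {mm : ℝ} {t εV : p → ℝ} (hDt : ∀ a, mm * D₀ a ^ 2 = εV a * t a)
    (hεV : ∀ a, εV a = 1 ∨ εV a = -1) (hα : εV (α 0) = εV (α 1)) :
    swapGL α hD₀ ∈ unitaryGroupOfForm (starRingEnd ℂ) ((Matrix.diagonal t).map Complex.ofRealHom) := by
  set σ := Equiv.swap (α 0) (α 1) with hσ
  have hεσ : ∀ a, εV (σ a) = εV a := fun a => by
    by_cases h0 : a = α 0
    · subst h0; rw [hσ, Equiv.swap_apply_left, hα]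
    by_cases h1 : a = α 1
    · subst h1; rw [hσ, Equiv.swap_apply_right, hα]
    rw [hσ, Equiv.swap_apply_of_ne_of_ne h0 h1]
  have htD : ∀ b, t b = mm * εV b * D₀ b ^ 2 := fun b => by
    rcases hεV b with h | h <;> · rw [h]; have := hDt b; rw [h] at this; nlinarith
  rw [mem_unitaryGroupOfForm_iff, coe_swapGL, swapMat_map_conj, Matrix.diagonal_map (map_zero _)]
  ext a c
  rw [Matrix.mul_apply, Finset.sum_eq_single (σ a)]
  · rw [Matrix.mul_diagonal, Matrix.transpose_apply, swapMat_apply, swapMat_apply, if_pos rfl, mul_one,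
      Complex.ofRealHom_eq_coe]
    by_cases hac : a = c
    · subst hac
      rw [if_pos rfl, mul_one, Matrix.diagonal_apply_eq, Complex.ofRealHom_eq_coe]
      have key : D₀ a / D₀ (σ a) * t (σ a) * (D₀ a / D₀ (σ a)) = t a := by
        rw [htD a, htD (σ a), hεσ]
        have := hD₀ (σ a)
        field_simp
      have key' := congrArg (fun r : ℝ => (r : ℂ)) key
      push_cast at key' ⊢
      linear_combination key'
    · rw [if_neg (fun h => hac (σ.injective h)), mul_zero, Complex.ofReal_zero, mul_zero,
        Matrix.diagonal_apply_ne _ hac]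
  · intro b _ hb
    rw [Matrix.mul_diagonal, Matrix.transpose_apply, swapMat_apply, if_neg hb, mul_zero, Complex.ofReal_zero,
      zero_mul, zero_mul]
  · exact fun h => (h (Finset.mem_univ _)).elim

omit hD₀ [Fintype p] in
/-- `swapMat` is sign-block when the two swapped rows have the same sign. [folklore] -/
theorem isSignBlock_swapMat {εV : p → ℝ} (hα : εV (α 0) = εV (α 1)) : IsSignBlock εV (swapMat D₀ α) := by
  intro b a hne
  rw [swapMat_apply]
  have hb : b ≠ Equiv.swap (α 0) (α 1) a := by
    intro h
    apply hne
    rw [h]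
    by_cases h0 : a = α 0
    · subst h0; rw [Equiv.swap_apply_left, hα]
    by_cases h1 : a = α 1
    · subst h1; rw [Equiv.swap_apply_right, hα]
    rw [Equiv.swap_apply_of_ne_of_ne h0 h1]
  rw [if_neg hb, mul_zero, Complex.ofReal_zero]

omit [Fintype p] in
/-- `det` of the `α`-block of `swapMat` is `−1`. [folklore] -/
theorem det_swapMat_block (hα : Function.Injective α) :
    (Matrix.of fun a' b' : Fin 2 => swapMat D₀ α (α a') (α b')).det = -1 := by
  have h01 : α 0 ≠ α 1 := fun h => zero_ne_one (hα h)
  have key : D₀ (α 1) / D₀ (α 0) * (D₀ (α 0) / D₀ (α 1)) = 1 := by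
    have := hD₀ (α 0); have := hD₀ (α 1); field_simp
  rw [Matrix.det_fin_two]
  simp only [Matrix.of_apply, swapMat_apply, Equiv.swap_apply_left, Equiv.swap_apply_right, if_true,
    if_neg h01, if_neg h01.symm, mul_zero, mul_one, Complex.ofReal_zero, zero_sub]
  rw [← Complex.ofReal_mul, key, Complex.ofReal_one]

omit [Fintype m] in
/-- **Substitution of the scaled swap**: `X (e (a, j)) ↦ X (e (σ a, j))`. [cite: Folland1989, Prop (4.39)] -/
theorem linSubst_star_follandUnitary_kronecker_swap_X (e : p × m ≃ ι) {D ε : ι → ℝ} {D₁ : m → ℝ}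
    {εV : p → ℝ} {εW : m → ℝ} (hD : ∀ a j, D (e (a, j)) = D₀ a * D₁ j) (hD₁ : ∀ j, D₁ j ≠ 0)
    (hε : ∀ a j, ε (e (a, j)) = εV a * εW j) (hα : εV (α 0) = εV (α 1)) (a : p) (j : m) :
    linSubst (star (follandUnitaryMatrix D ε (Matrix.reindex e e (swapMat D₀ α ⊗ₖ (1 : Matrix m m ℂ)))))
        (X (e (a, j))) = X (e (Equiv.swap (α 0) (α 1) a, j)) := by
  have hblock := isSignBlock_reindex_kronecker_one e _ (isSignBlock_swapMat (D₀ := D₀) α hα) hε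
  rw [linSubst_star_follandUnitary_kronecker_X e _ hD hD₁ hblock a j, Finset.sum_eq_single (Equiv.swap (α 0) (α 1) a)]
  · rw [swapMat_apply, if_pos rfl, mul_one, Complex.star_def, Complex.conj_ofReal, signConj_ofReal,
      ← Complex.ofReal_mul, div_mul_div_cancel₀ (hD₀ _), div_self (hD₀ _), Complex.ofReal_one, C_1, one_mul]
  · intro b _ hb
    rw [swapMat_apply, if_neg hb, mul_zero, Complex.ofReal_zero, star_zero, signConj_zero, mul_zero, C_0, zero_mul]
  · exact fun h => (h (Finset.mem_univ _)).elim

end Swap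

/-! ## §2 `det`-isotypic polynomials are multiples of `det2` -/

section Det

variable (e : p × m ≃ ι) (α : Fin 2 → p) (β : Fin 2 ≃ m) {D ε : ι → ℝ} {D₀ : p → ℝ} {D₁ : m → ℝ}
  {εV : p → ℝ} {w₀ mm : ℝ} {t : p → ℝ}

/-- The `2 × 2` array of the `+` rows and the two columns. [folklore] -/
def detVars : Fin 2 → Fin 2 → ι := fun a' j' => e (α a', β j')

omit [Fintype p] [DecidableEq p] [Fintype m] [DecidableEq m] [Fintype ι] [DecidableEq ι] in
/-- The array is injective. [folklore] -/
theorem detVars_injective (hα : Function.Injective α) :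
    Function.Injective fun q : Fin 2 × Fin 2 => detVars e α β q.1 q.2 := by
  rintro ⟨a, j⟩ ⟨a', j'⟩ h
  have h' : (α a, β j) = (α a', β j') := e.injective h
  rw [Prod.mk.injEq] at h'
  rw [hα h'.1, β.injective h'.2]

omit [Fintype p] [DecidableEq p] [DecidableEq m] [Fintype ι] in
/-- The row-`a'` variables of the array are all the variables of the row `α a'`. [folklore] -/
theorem rowVars_detVars (a' : Fin 2) :
    rowVars (detVars e α β) a' = Finset.univ.image fun j => e (α a', j) := by
  ext i
  simp only [rowVars, detVars, Finset.mem_image, Finset.mem_univ, true_and]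
  constructor
  · rintro ⟨j', rfl⟩; exact ⟨β j', rfl⟩
  · rintro ⟨j, rfl⟩; exact ⟨β.symm j, by rw [Equiv.apply_symm_apply]⟩

/-- `linSubst` of the indicator scaling of a row acts on each variable by the scalar or by `1`. [folklore] -/
theorem linSubst_indScale_X (S : Finset ι) (s : ℂ) (i : ι) :
    linSubst (indScale S s) (X i) = C (if i ∈ S then s else 1) * X i := by
  rw [linSubst_X, Finset.sum_eq_single i]
  · rw [indScale, Matrix.diagonal_apply_eq]
  · intro l _ hl; rw [indScale, Matrix.diagonal_apply_ne _ (Ne.symm hl), C_0, zero_mul]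
  · exact fun h => (h (Finset.mem_univ i)).elim

/-- **Main theorem (junction J2).**  Hypotheses: product scaling `D = D₀ ⊗ D₁` (`D₀, D₁ ≠ 0`), adapted
`mm D₀² = ε_V t` (`ε_V = ±1`), `W`-definite sign vector `ε (e (a, j)) = ε_V a · w₀`, two injective `+` rows `α`
(`ε_V (α a') w₀ = 1`; the other rows may have either sign), two columns `β : Fin 2 ≃ m`; `G` transforms under every
form-preserving sign-block `A` by the `det`-character of the `α`-block.  Then `G = c • det2 (detVars e α β)`.
[cite: KashiwaraVergne1978, Ch. III §5] -/
theorem exists_eq_smul_det2_of_forall_form (hα : Function.Injective α)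
    (hD : ∀ a j, D (e (a, j)) = D₀ a * D₁ j) (hD₁ : ∀ j, D₁ j ≠ 0) (hD₀0 : ∀ a, D₀ a ≠ 0)
    (hDt : ∀ a, mm * D₀ a ^ 2 = εV a * t a) (hεV : ∀ a, εV a = 1 ∨ εV a = -1)
    (hε : ∀ a j, ε (e (a, j)) = εV a * w₀) (hpos : ∀ a', εV (α a') * w₀ = 1) {G : MvPolynomial ι ℂ}
    (hG : ∀ A : GL p ℂ, A ∈ unitaryGroupOfForm (starRingEnd ℂ) ((Matrix.diagonal t).map Complex.ofRealHom) →
      IsSignBlock εV (A : Matrix p p ℂ) →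
      linSubst (star (follandUnitaryMatrix D ε
          (Matrix.reindex e e ((A : Matrix p p ℂ) ⊗ₖ (1 : Matrix m m ℂ))))) G =
        (Matrix.of fun a' b' : Fin 2 => (A : Matrix p p ℂ) (α a') (α b')).det • G) :
    ∃ c : ℂ, G = c • det2 (detVars e α β) := by
  have hx := detVars_injective e α β hα
  have hα01 : εV (α 0) = εV (α 1) := by
    have hw : w₀ ≠ 0 := fun h => by have h0 := hpos 0; rw [h, mul_zero] at h0; exact zero_ne_one h0
    exact mul_right_cancel₀ hw ((hpos 0).trans (hpos 1).symm)
  have hscale : ∀ (a₀ : p) (u : ℂ), ‖u‖ = 1 →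
      ∃ A : GL p ℂ, A ∈ unitaryGroupOfForm (starRingEnd ℂ) ((Matrix.diagonal t).map Complex.ofRealHom) ∧
        IsSignBlock εV (A : Matrix p p ℂ) ∧
        (Matrix.of fun a' b' : Fin 2 => (A : Matrix p p ℂ) (α a') (α b')).det =
          u ^ (if ∃ a', a₀ = α a' then 1 else 0) ∧
        linSubst (star (follandUnitaryMatrix D ε
            (Matrix.reindex e e ((A : Matrix p p ℂ) ⊗ₖ (1 : Matrix m m ℂ))))) =
          linSubst (indScale (Finset.univ.image fun j => e (a₀, j)) u) := by
    intro a₀ u hu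
    have hu1 : star u * u = 1 := by
      rw [Complex.star_def, ← Complex.normSq_eq_conj_mul_self, Complex.normSq_eq_norm_sq, hu]; norm_num
    have hu0 : u ≠ 0 := fun h => by rw [h, norm_zero] at hu; exact zero_ne_one hu
    set u' : ℂ := if εV a₀ * w₀ = 1 then u else star u with hu'
    have hu'1 : star u' * u' = 1 := by
      rw [hu']; split_ifs
      · exact hu1
      · rw [star_star, mul_comm, hu1]
    have hu'0 : u' ≠ 0 := by rw [hu']; split_ifs; exact hu0; exact star_ne_zero.mpr hu0
    set c : p → ℂ := Function.update (fun _ => (1 : ℂ)) a₀ u' with hc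
    have hc1 : ∀ a, star (c a) * c a = 1 := fun a => by
      rw [hc]; by_cases h : a = a₀
      · subst h; rw [Function.update_self]; exact hu'1
      · rw [Function.update_of_ne h, star_one, one_mul]
    have hc0 : ∀ a, c a ≠ 0 := fun a => by
      rw [hc]; by_cases h : a = a₀
      · subst h; rw [Function.update_self]; exact hu'0
      · rw [Function.update_of_ne h]; exact one_ne_zero
    have h01 : α 0 ≠ α 1 := fun h' => zero_ne_one (hα h')
    refine ⟨diagGL c hc0, diagGL_mem_unitaryGroupOfForm c hc1 hc0 t, ?_, ?_, ?_⟩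
    · rw [coe_diagGL]; exact isSignBlock_diagonal εV c
    · rw [coe_diagGL, Matrix.det_fin_two]
      simp only [Matrix.of_apply]
      rw [Matrix.diagonal_apply_ne _ h01, Matrix.diagonal_apply_ne _ h01.symm, Matrix.diagonal_apply_eq,
        Matrix.diagonal_apply_eq, mul_zero, sub_zero]
      by_cases hex : ∃ a', a₀ = α a'
      · obtain ⟨a', rfl⟩ := hex
        have hu'u : u' = u := by rw [hu']; exact if_pos (hpos a')
        rw [if_pos (⟨a', rfl⟩ : ∃ a'', α a' = α a''), pow_one]
        by_cases ha' : a' = 0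
        · subst ha'
          rw [hc, Function.update_self, Function.update_of_ne h01.symm, mul_one, hu'u]
        · obtain rfl : a' = 1 := by omega
          rw [hc, Function.update_of_ne h01, Function.update_self, one_mul, hu'u]
      · rw [if_neg hex, pow_zero, hc, Function.update_of_ne (fun h => hex ⟨0, h.symm⟩),
          Function.update_of_ne (fun h => hex ⟨1, h.symm⟩), mul_one]
    refine MvPolynomial.algHom_ext fun i => ?_
    obtain ⟨⟨a, j⟩, rfl⟩ := e.surjective i
    rw [coe_diagGL, linSubst_star_follandUnitary_kronecker_diagonal_X e c hD hD₁ hD₀0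
      (εV := εV) (εW := fun _ => w₀) hε a j, linSubst_indScale_X]
    congr 2
    by_cases ha : a = a₀
    · subst ha
      rw [hc, Function.update_self, if_pos (Finset.mem_image.mpr ⟨j, Finset.mem_univ _, rfl⟩), hu']
      by_cases hs : εV a * w₀ = 1
      · rw [if_pos hs, signConj_of_eq_one (by rw [hε, hs]), Complex.star_def, Complex.conj_conj]
      · rw [if_neg hs, signConj_of_ne_one (by rw [hε]; exact hs), star_star]
    · rw [hc, Function.update_of_ne ha, star_one, if_neg]
      · unfold signConj; split_ifs
        · exact map_one _
        · rfl
      · rintro h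
        obtain ⟨j', _, hj'⟩ := Finset.mem_image.mp h
        exact ha (Prod.mk.inj (e.injective hj')).1.symm
  have hwt : ∀ a₀ : p, IsWeightedHomogeneous (indWt (Finset.univ.image fun j => e (a₀, j))) G
      (if ∃ a', a₀ = α a' then 1 else 0) := by
    intro a₀
    refine isWeightedHomogeneous_indWt_of_linSubst _ fun u hu => ?_
    obtain ⟨A, hAform, hAblock, hAdet, hAsub⟩ := hscale a₀ u hu
    have h := hG A hAform hAblock
    rw [hAsub, hAdet] at h
    exact h
  have hrow : ∀ a', IsWeightedHomogeneous (rowWt (detVars e α β) a') G 1 := fun a' => by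
    have := hwt (α a'); rw [if_pos ⟨a', rfl⟩] at this; rw [rowWt, rowVars_detVars]; exact this
  have hS : rename (rowSwap (detVars e α β)) G = -G := by
    have hform := swapGL_mem_unitaryGroupOfForm α hD₀0 hDt hεV hα01
    have h := hG (swapGL α hD₀0) hform (by rw [coe_swapGL]; exact isSignBlock_swapMat α hα01)
    rw [coe_swapGL, det_swapMat_block α hD₀0 hα, neg_one_smul] at h
    rw [← h]
    refine AlgHom.congr_fun (MvPolynomial.algHom_ext fun i => ?_) G
    obtain ⟨⟨a, j⟩, rfl⟩ := e.surjective i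
    rw [rename_X, linSubst_star_follandUnitary_kronecker_swap_X α hD₀0 e hD hD₁ (εW := fun _ => w₀) hε hα01 a j]
    congr 1
    obtain ⟨j', rfl⟩ := β.surjective j
    by_cases ha0 : a = α 0
    · subst ha0
      rw [Equiv.swap_apply_left]
      exact rowSwap_apply_row0 hx j'
    by_cases ha1 : a = α 1
    · subst ha1
      rw [Equiv.swap_apply_right]
      exact rowSwap_apply_row1 hx j'
    rw [Equiv.swap_apply_of_ne_of_ne ha0 ha1, rowSwap_apply_of_notMem]
    · exact fun h => by obtain ⟨j'', _, hj⟩ := Finset.mem_image.mp h; exact ha0 (Prod.mk.inj (e.injective hj)).1.symm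
    · exact fun h => by obtain ⟨j'', _, hj⟩ := Finset.mem_image.mp h; exact ha1 (Prod.mk.inj (e.injective hj)).1.symm
  obtain ⟨hGH, hH⟩ := eq_det2_mul_of_rowSwap hx (hrow 0) (hrow 1) hS
  set H := pderiv (detVars e α β 1 1) (pderiv (detVars e α β 0 0) G) with hHdef
  have hHrow : ∀ a₀ : p, IsWeightedHomogeneous (indWt (Finset.univ.image fun j => e (a₀, j))) H 0 := by
    intro a₀
    by_cases hex : ∃ a', a₀ = α a'
    · obtain ⟨a', rfl⟩ := hex
      have := hH a'
      rw [rowWt, rowVars_detVars] at this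
      exact this
    · have hG0 := hwt a₀
      rw [if_neg hex] at hG0
      have hw : ∀ a' j', indWt (Finset.univ.image fun j => e (a₀, j)) (detVars e α β a' j') = 0 := by
        intro a' j'
        rw [indWt, if_neg]
        intro h
        obtain ⟨j'', _, hj⟩ := Finset.mem_image.mp h
        exact hex ⟨a', (Prod.mk.inj (e.injective hj)).1⟩
      rw [hHdef]
      exact (hG0.pderiv (n' := 0) (by rw [hw, add_zero])).pderiv (n' := 0) (by rw [hw, add_zero])
  have hHC : H = C (coeff 0 H) := by
    rw [← totalDegree_eq_zero_iff_eq_C, totalDegree_eq_zero_iff]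
    intro d hd i
    obtain ⟨⟨a, j⟩, rfl⟩ := e.surjective i
    have hw := hHrow a (mem_support_iff.mp hd)
    rw [weight_indWt] at hw
    exact Finset.sum_eq_zero_iff.mp hw _ (Finset.mem_image.mpr ⟨j, Finset.mem_univ _, rfl⟩)
  refine ⟨coeff 0 H, ?_⟩
  rw [hGH]
  conv_lhs => rw [hHC]
  rw [mul_comm, smul_eq_C_mul]

end Det

end Literature.NumberTheory.Weil1964

end
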